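import Summits.ABC.StewartYu.DescentSetupQ
import Literature.NumberTheory.Transcendental.Waldschmidt1980SizesB
import HarnessLib

/-!
# Cell abc-stewartyu, WP-A3 (viii): the archimedean SIZE estimates of Waldschmidt 1980 for the
# signed set-up, imported through the flattening `S♭`

`Summits/ABC/StewartYu/DescentSizesQ.lean` — cell `abc-stewartyu` (HOME
`run/shared/lean/pub/abc-stewartyu/`, seat p3; rows "W80Sizes/W80SizesB (class H)" of
`HOME/plan/PORT-MAP.md`; theorems only, no named fact), sequel to `DescentSetupQ.lean`.

The `p`-adic proof needs the SIZES (archimedean absolute values, as heights) and DENOMINATORS of the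
algebraic numbers it evaluates — exactly the content of the tree's `Waldschmidt1980Sizes*.lean`,
which is stated for `S : CW77.Setup` under `hy : S.W80Hyp P` (`P : W80Par S.d` Waldschmidt's
parameters).  Since the signed cores of `Q : SetupQ` have the same absolute values and denominators
as those of `Q.flat` (`SetupQ.abs_qTerm`, `abs_rHalf`, …), nothing is re-proved here:

* `hgt_abs`, `abs_log_abs_le_log_hgt` — `H(|q|) = H(q)` and `|log |q|| ≤ log H(q)` (`q ≠ 0`);
* `flat_W80Hyp` — **the hypothesis structure `W80Hyp` for `Q.flat`** from the sign-free data
  `log H(αⱼ) ≤ Vⱼ`, `log H(θ) ≤ V_θ`, `|bⱼ|, |b_θ| ≤ e^W` (for positive rationals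
  `|log α| ≤ log H(α)` is automatic, so the `p`-adic hypothesis list has NO `|log αⱼ| ≤ Vⱼ` clause);
* the signed corollaries used by Siegel's lemma and by the two Liouville steps:
  `abs_Dclear_qTerm_le` (`|Dclear♭ · qTerm| ≤ 𝔅⁴ E(2)`), `abs_rHalf_le` (`|rHalf| ≤ 𝔅² E(2)`),
  `sum_abs_classVec_le_card` (`∑|classVec| ≤ #box · Pr · Rmax`), `heightProd_all_le`
  (`∏ H(allᵢ) ≤ exp(∑ Vallᵢ)`).

Everything is [folklore].
-/

noncomputable section

open Finset
open Literature.NumberTheory.Transcendental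
open Literature.NumberTheory.Transcendental.CW77
open Literature.NumberTheory.Transcendental.CW77.Setup (Idx Tau tauNorm scale tauSet)
open Literature.NumberTheory.Transcendental.Waldschmidt1980 (W80Par)
open Literature.NumberTheory.Transcendental.Waldschmidt1980.W80Par (cL')

namespace Summit.ABC.StewartYu

namespace SetupQ

/-! ### Heights do not see signs -/

/-- `H(|q|) = H(q)`. [folklore] -/
theorem hgt_abs (q : ℚ) : hgt |q| = hgt q := by
  unfold hgt
  rw [Rat.num_abs_eq_abs_num, Rat.den_abs_eq_den, Int.natAbs_abs]

/-- `|log |q|| ≤ log H(q)` for a non-zero rational `q` (`|q| = |num|/den` with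
`1 ≤ |num|, den ≤ H(q)`). [folklore] -/
theorem abs_log_abs_le_log_hgt {q : ℚ} (hq : q ≠ 0) : |Real.log (|(q : ℝ)|)| ≤ Real.log (hgt q) := by
  have hnum : (1 : ℝ) ≤ (q.num.natAbs : ℝ) := by
    exact_mod_cast Nat.one_le_iff_ne_zero.mpr (Int.natAbs_ne_zero.mpr (Rat.num_ne_zero.mpr hq))
  have hden : (1 : ℝ) ≤ (q.den : ℝ) := by exact_mod_cast q.den_pos
  have hH1 : (q.num.natAbs : ℝ) ≤ hgt q := by
    unfold hgt; exact_mod_cast le_max_left _ _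
  have hH2 : (q.den : ℝ) ≤ hgt q := by
    unfold hgt; exact_mod_cast le_max_right _ _
  have habs : |(q : ℝ)| = (q.num.natAbs : ℝ) / q.den := by
    have h1 : ((q.num.natAbs : ℕ) : ℝ) = |(q.num : ℝ)| := by
      rw [← Int.cast_natCast, Int.natCast_natAbs, Int.cast_abs]
    rw [h1, Rat.cast_def, abs_div, Nat.abs_cast]
  rw [habs, Real.log_div (by positivity) (by positivity), abs_le]
  constructor
  · have h1 : 0 ≤ Real.log (q.num.natAbs : ℝ) := Real.log_nonneg hnum
    have h2 : Real.log (q.den : ℝ) ≤ Real.log (hgt q) := Real.log_le_log (by positivity) hH2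
    linarith
  · have h1 : 0 ≤ Real.log (q.den : ℝ) := Real.log_nonneg hden
    have h2 : Real.log (q.num.natAbs : ℝ) ≤ Real.log (hgt q) := Real.log_le_log (by positivity) hH1
    linarith

variable (Q : SetupQ) {h Lb : ℕ}

/-- `H(all♭ᵢ) = H(allᵢ)`, hence `∏ H(all♭ᵢ) = ∏ H(allᵢ)`. [folklore] -/
theorem heightProd_flat_all : heightProd Q.flat.all = heightProd Q.all := by
  unfold heightProd
  exact prod_congr rfl fun i _ => by rw [Q.flat_all, hgt_abs]

/-! ### `W80Hyp` for the flattening from sign-free height data -/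

/-- **Waldschmidt's hypothesis structure for `Q.flat`** from the sign-free data: heights
`log H(αⱼ) ≤ Vⱼ`, `log H(θ) ≤ V_θ` and coefficients `|bⱼ|, |b_θ| ≤ e^W`. [folklore] -/
theorem flat_W80Hyp (P : W80Par Q.d) (hH : ∀ j, Real.log (hgt (Q.α j)) ≤ P.V j)
    (hHθ : Real.log (hgt Q.θ) ≤ P.Vθ) (hb : ∀ j, |(Q.b j : ℝ)| ≤ Real.exp P.W)
    (hbθ : |(Q.bθ : ℝ)| ≤ Real.exp P.W) : Q.flat.W80Hyp P where
  hH := fun j => by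
    show Real.log (hgt |Q.α j|) ≤ P.V j
    rw [hgt_abs]; exact hH j
  hl := fun j => by
    show |Real.log ((|Q.α j| : ℚ) : ℝ)| ≤ P.V j
    rw [Rat.cast_abs]
    exact (abs_log_abs_le_log_hgt (Q.α_ne j)).trans (hH j)
  hHθ := by
    show Real.log (hgt |Q.θ|) ≤ P.Vθ
    rw [hgt_abs]; exact hHθ
  hlθ := by
    show |Real.log ((|Q.θ| : ℚ) : ℝ)| ≤ P.Vθ
    rw [Rat.cast_abs]
    exact (abs_log_abs_le_log_hgt Q.θ_ne).trans hHθ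
  hb := hb
  hbθ := hbθ

/-! ### The signed corollaries -/

variable {Q}
variable {P : W80Par Q.d} (hy : Q.flat.W80Hyp P)
include hy

/-- **`|Dclear♭(s,τ) · qTerm_{0}(u,τ,s)| ≤ 𝔅⁴ E(2)`** for the SIGNED core on the box of level `0`
(`s < S₀`, `|τ| < T`): the coefficient bound `Amax` of `SetupQ.siegel_step`. [folklore] -/
theorem abs_Dclear_qTerm_le {s : ℕ} (hs : s < P.S₀) {τ : Tau Q.d} (hτ : tauNorm τ < P.T)
    {u : Idx Q.d P.hpar P.Lb} (hu : u ∈ Q.flat.box (h := P.hpar) (Lb := P.Lb) P.L P.Lθ 0) :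
    |((Q.flat.Dclear (h := P.hpar) P.J₀ P.L P.Lθ s τ : ℕ) : ℝ) * (Q.qTerm (h := P.hpar) P.J₀ 0 u τ s : ℝ)| ≤
      P.𝔅 ^ 4 * Real.exp (2 * (P.𝔘 / (2 * cL'))) := by
  have h1 := hy.abs_Dclear_qTerm_le hs hτ hu
  rw [abs_mul] at h1 ⊢
  have h2 : |(Q.qTerm (h := P.hpar) P.J₀ 0 u τ s : ℝ)| = |(Q.flat.qTerm (h := P.hpar) P.J₀ 0 u τ s : ℝ)| := by
    rw [← Rat.cast_abs, ← Rat.cast_abs, Q.abs_qTerm]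
  rwa [h2]

/-- **`|rHalf_{J}(u,τ,s)| ≤ 𝔅² E(2)`** for the SIGNED half-point coefficient (`J < J₀`, `u` in the box
of level `J`, `|τ| ≤ T`, `s < 2^{J+1} S₀`). [folklore] -/
theorem abs_rHalf_le {J : ℕ} (hJ : J < P.J₀) {u : Idx Q.d P.hpar P.Lb}
    (hu : u ∈ Q.flat.box (h := P.hpar) (Lb := P.Lb) P.L P.Lθ J) {τ : Tau Q.d} (hτ : tauNorm τ ≤ P.T)
    {s : ℕ} (hs : s < 2 ^ (J + 1) * P.S₀) :
    |(Q.rHalf (h := P.hpar) P.J₀ J u τ s : ℝ)| ≤ P.𝔅 ^ 2 * Real.exp (2 * (P.𝔘 / (2 * cL'))) := by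
  have h1 := hy.abs_rHalf_le hJ hu hτ hs
  have h2 : |(Q.rHalf (h := P.hpar) P.J₀ J u τ s : ℝ)| = |(Q.flat.rHalf (h := P.hpar) P.J₀ J u τ s : ℝ)| := by
    rw [← Rat.cast_abs, ← Rat.cast_abs, Q.abs_rHalf]
  rwa [h2]

/-- `∏ᵢ H(allᵢ) ≤ exp(∑ᵢ Vallᵢ)` for the signed generators. [folklore] -/
theorem heightProd_all_le : heightProd Q.all ≤ Real.exp (∑ i, P.Vall i) := by
  rw [← Q.heightProd_flat_all]; exact hy.heightProd_le

omit hy in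
/-- `∑_{T'} |classVec(T')| ≤ #box · Pr · Rmax` from `|p(u)| ≤ Pr` and `|rHalf(u)| ≤ Rmax` on the box.
[folklore] -/
theorem sum_abs_classVec_le_card (J₀ J : ℕ) (box : Finset (Idx Q.d h Lb)) (p : Idx Q.d h Lb → ℤ)
    (τ : Tau Q.d) (s : ℕ) {Pr Rmax : ℝ} (hPr : 0 ≤ Pr) (hp : ∀ u ∈ box, |(p u : ℝ)| ≤ Pr)
    (hR : ∀ u ∈ box, |(Q.rHalf J₀ J u τ s : ℝ)| ≤ Rmax) :
    ∑ T', |(Q.classVec J₀ J box p τ s T' : ℝ)| ≤ box.card * Pr * Rmax := by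
  refine (Q.sum_abs_classVec_le J₀ J box p τ s).trans ?_
  calc ∑ u ∈ box, |(p u : ℝ)| * |(Q.rHalf J₀ J u τ s : ℝ)|
      ≤ ∑ u ∈ box, Pr * Rmax :=
        sum_le_sum fun u hu => mul_le_mul (hp u hu) (hR u hu) (abs_nonneg _) hPr
    _ = box.card * Pr * Rmax := by rw [sum_const, nsmul_eq_mul]; ring

end SetupQ

end Summit.ABC.StewartYu

end
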